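import Mathlib
import Literature.NumberTheory.Transcendental.KZCalculus
import Literature.NumberTheory.Transcendental.KZSemialgebraicComplex
import Literature.NumberTheory.Transcendental.SemialgebraicMapsProofs
import Literature.NumberTheory.Transcendental.KZCalculusProofs
import Literature.NumberTheory.Transcendental.KZLogCalculusProofs
import Summits.KontsevichZagierPeriods.KontsevichZagierPeriods.Theses.UnfoldedStokes
import Summits.KontsevichZagierPeriods.KontsevichZagierPeriods.Theorems.UnfoldedStokesHyperellipticRiemannRelationStubEngine
import Summits.KontsevichZagierPeriods.KontsevichZagierPeriods.Theorems.UnfoldedStokesHyperellipticRiemannRelationStubFacesGaps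
import Summits.KontsevichZagierPeriods.KontsevichZagierPeriods.Theorems.UnfoldedStokesHyperellipticRiemannRelationStubFacesReps
import Summits.KontsevichZagierPeriods.KontsevichZagierPeriods.Theorems.UnfoldedStokesHyperellipticRiemannRelationStubKernelCalculusAux
import Summits.KontsevichZagierPeriods.KontsevichZagierPeriods.Theorems.UnfoldedStokesHyperellipticRiemannRelationStubKernelCalculusAux2
import Summits.KontsevichZagierPeriods.KontsevichZagierPeriods.Theorems.UnfoldedStokesHyperellipticRiemannRelationStubKernelCalculusAux3

/-!
# `HyperellipticRiemannRelation` (stmt-KontsevichZagierPeriods-3522), line `SketchIdeator2`: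
# stub `stub_kernelCalculus` — the kernels satisfy the engine hypotheses

Registered stub `stub_kernelCalculus` of the line skeleton: the non-integrability hypotheses of the
abstract two-move engine (`stub_engine`) for the two kernels of the fibred half-plane transport,
read in the coordinates `w = (u, τ, σ)`, `(x₀, x₁, s) = (τ − u, τ, σ/(1−σ))`:

* (I) the ordered simplex kernel `K(x₀,x₁,s) = (x₁+is)/(Φ(x₀+is)Φ(x₁+is))`, `V = Im K` (zero at
  `σ = 1`), `U = Re K/(1−σ)²`, bulk `B = Re K′/(1−σ)²`, over the spectator set `A = (0,∞)` and the
  base `D = {u > 0, τ ∉ E, τ − u ∉ E}`;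
* (II) the spectator kernel `ρ(x₀) (x₁+is)/Φ(x₁+is)` (`ρ = 1/√|P|` frozen at height `0`),
  `V = ρ Re k`, `U = −ρ Im k/(1−σ)²`, `B = −ρ Im k′/(1−σ)²`, over each gap `A = J_L` of
  `ℝ ∖ E` and the base `J_L × (ℝ ∖ E)`.

Per kernel: `A`, `D` semialgebraic (`D` of full measure), `V` semialgebraic on the closed band and
`B`, `U` on the open prism (file `…Aux3`); `σ ↦ V` continuous on `[0,1]` (`√·` continuous from above
on the cut; decay as `s → ∞`, file `…Aux2`) with `∂_σ V = B`; `∂_τ U = B` with `U → 0` at `±∞`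
(transport laws `∂ₛ K = iK′`, `∂_τ K = K′`, file `…Aux`; decay from the `stub_bounds` hypothesis).
The simplex base and the gaps `J_L` come from the sibling files `…StubFacesReps.lean`,
`…StubFacesGaps.lean`. No definitions.
References: Kontsevich–Zagier 2001, §1.2 rule (3); Bochnak–Coste–Roy 1998, §2.2.
-/

noncomputable section

namespace Summit.KontsevichZagierPeriods.UnfoldedStokes.HyperellipticRiemannRelationLine

open Set MeasureTheory Filter Topology
open Literature.NumberTheory.Transcendental
open Literature.ModelTheory.ExponentialFields (IsSemialgebraic)
open KernelCalculus

/-- **Kernel calculus.** For the simplex kernel `K(x₀,x₁,s) = (x₁+is)/(Φ(x₀+is)Φ(x₁+is))` and its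
`τ`-derivative `K′ = (1 − (z₁/2) Σⱼ ((z₀−eⱼ)⁻¹ + (z₁−eⱼ)⁻¹))/(Φ(z₀)Φ(z₁))` read in the coordinates
`w = (u, τ, σ)`, `(x₀,x₁,s) = (τ−u, τ, σ/(1−σ))`: `V = Im K` (zero at `σ = 1`), `U = Re K/(1−σ)²`,
`B = Re K′/(1−σ)²` satisfy the engine hypotheses over `A = (0,∞)`, base
`D = {u > 0, τ ∉ E, τ−u ∉ E}` (Cauchy–Riemann: `∂ₛK = iK′`, `∂_τK = K′`; `√·` is continuous from
above on the cut, so `V` is continuous at `σ = 0` off the branch lines; decay from the bounds); and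
likewise the spectator kernel `ρ(x₀) · (x₁+is)/Φ(x₁+is)` (`ρ = 1/√|P|` frozen at height `0`,
`V₁ = ρ Re k`, `U₁ = −ρ Im k/(1−σ)²`, `B₁ = −ρ Im k′/(1−σ)²`, `k′ = (1 − (z/2)Σⱼ(z−eⱼ)⁻¹)/Φ(z)`)
over `A = J_L`, `D = J_L × (ℝ \ E)`, for each of the six gaps `J_L`.
[cite: KontsevichZagier2001, §1.2 rule (3)] -/
theorem stub_kernelCalculus :
    ∀ (e : Fin 5 → ℚ), StrictMono e →
    ∀ (Φ : ℂ → ℂ), (∀ z, Φ z = ∏ j : Fin 5, Complex.sqrt (z - ((e j : ℝ) : ℂ))) →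
    ∀ (m : ℝ → ℝ), (∀ x, m x =
        (1 + ∑ k : Fin 5, |x - (e k : ℝ)| ^ (-(3:ℝ) / 4)) * (1 + x ^ 2) ^ (-(5:ℝ) / 8)) →
    (Integrable m ∧
      IntegrableOn (fun s : ℝ => (1 + s ^ (-(3:ℝ) / 4)) * (1 + s ^ 2) ^ (-(5:ℝ) / 8)) (Ioi 0) ∧
      IntegrableOn (fun s : ℝ => (1 + s ^ (-(3:ℝ) / 4)) * (1 + s ^ 2) ^ (-(5:ℝ) / 4)) (Ioi 0) ∧
      ∃ C : ℝ, 0 < C ∧ ∀ (x s : ℝ), 0 ≤ s → (∀ j, x ≠ (e j : ℝ)) →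
        ‖(Φ ((x : ℂ) + (s : ℂ) * Complex.I))⁻¹‖ ≤ C * m x * (1 + s ^ 2) ^ (-(5:ℝ) / 8) ∧
        ‖((x : ℂ) + (s : ℂ) * Complex.I) / Φ ((x : ℂ) + (s : ℂ) * Complex.I)‖ ≤
          C * m x * (1 + s ^ 2) ^ (-(1:ℝ) / 8) ∧
        (0 < s →
          ‖(Φ ((x : ℂ) + (s : ℂ) * Complex.I))⁻¹ *
              ∑ j : Fin 5, ((x : ℂ) + (s : ℂ) * Complex.I - ((e j : ℝ) : ℂ))⁻¹‖ ≤
            C * m x * (1 + s ^ (-(3:ℝ) / 4)) * (1 + s ^ 2) ^ (-(9:ℝ) / 8) ∧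
          ‖(1 - ((x : ℂ) + (s : ℂ) * Complex.I) / 2 *
                ∑ j : Fin 5, ((x : ℂ) + (s : ℂ) * Complex.I - ((e j : ℝ) : ℂ))⁻¹) /
              Φ ((x : ℂ) + (s : ℂ) * Complex.I)‖ ≤
            C * m x * (1 + s ^ (-(3:ℝ) / 4)) * (1 + s ^ 2) ^ (-(5:ℝ) / 8))) →
    (∀ (K K' : ℝ → ℝ → ℝ → ℂ) (V U B : (Fin 3 → ℝ) → ℝ),
      (∀ x₀ x₁ s, K x₀ x₁ s = ((x₁ : ℂ) + (s : ℂ) * Complex.I) /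
        (Φ ((x₀ : ℂ) + (s : ℂ) * Complex.I) * Φ ((x₁ : ℂ) + (s : ℂ) * Complex.I))) →
      (∀ x₀ x₁ s, K' x₀ x₁ s =
        (1 - ((x₁ : ℂ) + (s : ℂ) * Complex.I) / 2 *
          ∑ j : Fin 5, (((x₀ : ℂ) + (s : ℂ) * Complex.I - ((e j : ℝ) : ℂ))⁻¹ +
            ((x₁ : ℂ) + (s : ℂ) * Complex.I - ((e j : ℝ) : ℂ))⁻¹)) /
        (Φ ((x₀ : ℂ) + (s : ℂ) * Complex.I) * Φ ((x₁ : ℂ) + (s : ℂ) * Complex.I))) →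
      (∀ w, V w = if w 2 < 1 then (K (w 1 - w 0) (w 1) (w 2 / (1 - w 2))).im else 0) →
      (∀ w, U w = 1 / (1 - w 2) ^ 2 * (K (w 1 - w 0) (w 1) (w 2 / (1 - w 2))).re) →
      (∀ w, B w = 1 / (1 - w 2) ^ 2 * (K' (w 1 - w 0) (w 1) (w 2 / (1 - w 2))).re) →
      IsSemialgebraic ℚ {t : Fin 1 → ℝ | t 0 ∈ Ioi (0:ℝ)} ∧
      IsSemialgebraic ℚ {y : Fin 2 → ℝ | 0 < y 0 ∧ ∀ j, y 1 ≠ (e j : ℝ) ∧ y 1 - y 0 ≠ (e j : ℝ)} ∧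
      {y : Fin 2 → ℝ | 0 < y 0 ∧ ∀ j, y 1 ≠ (e j : ℝ) ∧ y 1 - y 0 ≠ (e j : ℝ)} ⊆
        {y : Fin 2 → ℝ | y 0 ∈ Ioi (0:ℝ)} ∧
      volume ({y : Fin 2 → ℝ | y 0 ∈ Ioi (0:ℝ)} \
        {y : Fin 2 → ℝ | 0 < y 0 ∧ ∀ j, y 1 ≠ (e j : ℝ) ∧ y 1 - y 0 ≠ (e j : ℝ)}) = 0 ∧
      IsSemialgebraicFunOn ℚ
        {w : Fin 3 → ℝ | (![w 0, w 1] : Fin 2 → ℝ) ∈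
            {y : Fin 2 → ℝ | 0 < y 0 ∧ ∀ j, y 1 ≠ (e j : ℝ) ∧ y 1 - y 0 ≠ (e j : ℝ)} ∧
          0 ≤ w 2 ∧ w 2 ≤ 1} V ∧
      (∀ y ∈ {y : Fin 2 → ℝ | 0 < y 0 ∧ ∀ j, y 1 ≠ (e j : ℝ) ∧ y 1 - y 0 ≠ (e j : ℝ)},
        ContinuousOn (fun σ : ℝ => V ![y 0, y 1, σ]) (Icc 0 1) ∧ V ![y 0, y 1, 1] = 0 ∧
        ∀ σ ∈ Ioo (0:ℝ) 1, HasDerivAt (fun σ : ℝ => V ![y 0, y 1, σ]) (B ![y 0, y 1, σ]) σ) ∧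
      IsSemialgebraicFunOn ℚ {w : Fin 3 → ℝ | w 0 ∈ Ioi (0:ℝ) ∧ 0 < w 2 ∧ w 2 < 1} B ∧
      IsSemialgebraicFunOn ℚ {w : Fin 3 → ℝ | w 0 ∈ Ioi (0:ℝ) ∧ 0 < w 2 ∧ w 2 < 1} U ∧
      (∀ a ∈ Ioi (0:ℝ), ∀ σ ∈ Ioo (0:ℝ) 1,
        (∀ τ : ℝ, HasDerivAt (fun τ : ℝ => U ![a, τ, σ]) (B ![a, τ, σ]) τ) ∧
        Tendsto (fun τ : ℝ => U ![a, τ, σ]) atTop (𝓝 0) ∧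
        Tendsto (fun τ : ℝ => U ![a, τ, σ]) atBot (𝓝 0))) ∧
    (∀ (ρ : ℝ → ℝ) (k k' : ℝ → ℝ → ℂ) (V U B : (Fin 3 → ℝ) → ℝ),
      (∀ t, ρ t = 1 / Real.sqrt |∏ i : Fin 5, (t - (e i : ℝ))|) →
      (∀ x s, k x s = ((x : ℂ) + (s : ℂ) * Complex.I) / Φ ((x : ℂ) + (s : ℂ) * Complex.I)) →
      (∀ x s, k' x s = (1 - ((x : ℂ) + (s : ℂ) * Complex.I) / 2 *
          ∑ j : Fin 5, ((x : ℂ) + (s : ℂ) * Complex.I - ((e j : ℝ) : ℂ))⁻¹) /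
        Φ ((x : ℂ) + (s : ℂ) * Complex.I)) →
      (∀ w, V w = if w 2 < 1 then ρ (w 0) * (k (w 1) (w 2 / (1 - w 2))).re else 0) →
      (∀ w, U w = -(1 / (1 - w 2) ^ 2 * ρ (w 0) * (k (w 1) (w 2 / (1 - w 2))).im)) →
      (∀ w, B w = -(1 / (1 - w 2) ^ 2 * ρ (w 0) * (k' (w 1) (w 2 / (1 - w 2))).im)) →
      ∀ L : Fin 6,
      IsSemialgebraic ℚ {t : Fin 1 → ℝ | t 0 ∈
        (![Set.Iio (e 0 : ℝ), Set.Ioo (e 0 : ℝ) (e 1 : ℝ), Set.Ioo (e 1 : ℝ) (e 2 : ℝ),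
           Set.Ioo (e 2 : ℝ) (e 3 : ℝ), Set.Ioo (e 3 : ℝ) (e 4 : ℝ), Set.Ioi (e 4 : ℝ)] : Fin 6 → Set ℝ) L} ∧
      IsSemialgebraic ℚ {y : Fin 2 → ℝ | y 0 ∈
        (![Set.Iio (e 0 : ℝ), Set.Ioo (e 0 : ℝ) (e 1 : ℝ), Set.Ioo (e 1 : ℝ) (e 2 : ℝ),
           Set.Ioo (e 2 : ℝ) (e 3 : ℝ), Set.Ioo (e 3 : ℝ) (e 4 : ℝ), Set.Ioi (e 4 : ℝ)] : Fin 6 → Set ℝ) L ∧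
          ∀ j, y 1 ≠ (e j : ℝ)} ∧
      {y : Fin 2 → ℝ | y 0 ∈
        (![Set.Iio (e 0 : ℝ), Set.Ioo (e 0 : ℝ) (e 1 : ℝ), Set.Ioo (e 1 : ℝ) (e 2 : ℝ),
           Set.Ioo (e 2 : ℝ) (e 3 : ℝ), Set.Ioo (e 3 : ℝ) (e 4 : ℝ), Set.Ioi (e 4 : ℝ)] : Fin 6 → Set ℝ) L ∧
          ∀ j, y 1 ≠ (e j : ℝ)} ⊆
        {y : Fin 2 → ℝ | y 0 ∈
          (![Set.Iio (e 0 : ℝ), Set.Ioo (e 0 : ℝ) (e 1 : ℝ), Set.Ioo (e 1 : ℝ) (e 2 : ℝ),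
             Set.Ioo (e 2 : ℝ) (e 3 : ℝ), Set.Ioo (e 3 : ℝ) (e 4 : ℝ), Set.Ioi (e 4 : ℝ)] : Fin 6 → Set ℝ) L} ∧
      volume ({y : Fin 2 → ℝ | y 0 ∈
          (![Set.Iio (e 0 : ℝ), Set.Ioo (e 0 : ℝ) (e 1 : ℝ), Set.Ioo (e 1 : ℝ) (e 2 : ℝ),
             Set.Ioo (e 2 : ℝ) (e 3 : ℝ), Set.Ioo (e 3 : ℝ) (e 4 : ℝ), Set.Ioi (e 4 : ℝ)] : Fin 6 → Set ℝ) L} \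
        {y : Fin 2 → ℝ | y 0 ∈
          (![Set.Iio (e 0 : ℝ), Set.Ioo (e 0 : ℝ) (e 1 : ℝ), Set.Ioo (e 1 : ℝ) (e 2 : ℝ),
             Set.Ioo (e 2 : ℝ) (e 3 : ℝ), Set.Ioo (e 3 : ℝ) (e 4 : ℝ), Set.Ioi (e 4 : ℝ)] : Fin 6 → Set ℝ) L ∧
            ∀ j, y 1 ≠ (e j : ℝ)}) = 0 ∧
      IsSemialgebraicFunOn ℚ
        {w : Fin 3 → ℝ | (![w 0, w 1] : Fin 2 → ℝ) ∈
            {y : Fin 2 → ℝ | y 0 ∈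
              (![Set.Iio (e 0 : ℝ), Set.Ioo (e 0 : ℝ) (e 1 : ℝ), Set.Ioo (e 1 : ℝ) (e 2 : ℝ),
                 Set.Ioo (e 2 : ℝ) (e 3 : ℝ), Set.Ioo (e 3 : ℝ) (e 4 : ℝ), Set.Ioi (e 4 : ℝ)] : Fin 6 → Set ℝ) L ∧
                ∀ j, y 1 ≠ (e j : ℝ)} ∧
          0 ≤ w 2 ∧ w 2 ≤ 1} V ∧
      (∀ y ∈ {y : Fin 2 → ℝ | y 0 ∈
          (![Set.Iio (e 0 : ℝ), Set.Ioo (e 0 : ℝ) (e 1 : ℝ), Set.Ioo (e 1 : ℝ) (e 2 : ℝ),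
             Set.Ioo (e 2 : ℝ) (e 3 : ℝ), Set.Ioo (e 3 : ℝ) (e 4 : ℝ), Set.Ioi (e 4 : ℝ)] : Fin 6 → Set ℝ) L ∧
            ∀ j, y 1 ≠ (e j : ℝ)},
        ContinuousOn (fun σ : ℝ => V ![y 0, y 1, σ]) (Icc 0 1) ∧ V ![y 0, y 1, 1] = 0 ∧
        ∀ σ ∈ Ioo (0:ℝ) 1, HasDerivAt (fun σ : ℝ => V ![y 0, y 1, σ]) (B ![y 0, y 1, σ]) σ) ∧
      IsSemialgebraicFunOn ℚ {w : Fin 3 → ℝ | w 0 ∈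
          (![Set.Iio (e 0 : ℝ), Set.Ioo (e 0 : ℝ) (e 1 : ℝ), Set.Ioo (e 1 : ℝ) (e 2 : ℝ),
             Set.Ioo (e 2 : ℝ) (e 3 : ℝ), Set.Ioo (e 3 : ℝ) (e 4 : ℝ), Set.Ioi (e 4 : ℝ)] : Fin 6 → Set ℝ) L ∧
        0 < w 2 ∧ w 2 < 1} B ∧
      IsSemialgebraicFunOn ℚ {w : Fin 3 → ℝ | w 0 ∈
          (![Set.Iio (e 0 : ℝ), Set.Ioo (e 0 : ℝ) (e 1 : ℝ), Set.Ioo (e 1 : ℝ) (e 2 : ℝ),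
             Set.Ioo (e 2 : ℝ) (e 3 : ℝ), Set.Ioo (e 3 : ℝ) (e 4 : ℝ), Set.Ioi (e 4 : ℝ)] : Fin 6 → Set ℝ) L ∧
        0 < w 2 ∧ w 2 < 1} U ∧
      (∀ a ∈ (![Set.Iio (e 0 : ℝ), Set.Ioo (e 0 : ℝ) (e 1 : ℝ), Set.Ioo (e 1 : ℝ) (e 2 : ℝ),
             Set.Ioo (e 2 : ℝ) (e 3 : ℝ), Set.Ioo (e 3 : ℝ) (e 4 : ℝ), Set.Ioi (e 4 : ℝ)] : Fin 6 → Set ℝ) L,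
        ∀ σ ∈ Ioo (0:ℝ) 1,
        (∀ τ : ℝ, HasDerivAt (fun τ : ℝ => U ![a, τ, σ]) (B ![a, τ, σ]) τ) ∧
        Tendsto (fun τ : ℝ => U ![a, τ, σ]) atTop (𝓝 0) ∧
        Tendsto (fun τ : ℝ => U ![a, τ, σ]) atBot (𝓝 0))) := by
  intro e he Φ hΦ m hm hbounds
  obtain ⟨-, -, -, hbd⟩ := hbounds
  refine ⟨?_, ?_⟩
  · /- (I) the ordered simplex kernel over `A = (0,∞)` -/
    intro K K' V U B hK hK' hV hU hB
    have hA : IsSemialgebraic ℚ {t : Fin 1 → ℝ | t 0 ∈ Ioi (0:ℝ)} := by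
      simpa using Literature.ModelTheory.ExponentialFields.isSemialgebraic_setOf_eval_pos (k := ℚ)
        (R := ℝ) (MvPolynomial.X 0 : MvPolynomial (Fin 1) ℚ)
    have hD := Faces.isSemialgebraic_shearBase e
    -- the half-open band below `σ = 1` and the open prism
    set T₁ : Set (Fin 3 → ℝ) := {w : Fin 3 → ℝ | (![w 0, w 1] : Fin 2 → ℝ) ∈
        {y : Fin 2 → ℝ | 0 < y 0 ∧ ∀ j, y 1 ≠ (e j : ℝ) ∧ y 1 - y 0 ≠ (e j : ℝ)} ∧
      0 ≤ w 2 ∧ w 2 < 1} with hT₁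
    have hT₁s : IsSemialgebraic ℚ T₁ := isSemialgebraic_band_lt hD
    have hT₁1 : ∀ w ∈ T₁, w 2 ≠ 1 := fun w hw => ne_of_lt hw.2.2
    have hT₁D : ∀ w ∈ T₁, ∀ j, w 1 ≠ (e j : ℝ) ∧ w 1 - w 0 ≠ (e j : ℝ) := fun w hw => by
      have h := hw.1
      simp only [mem_setOf_eq, Matrix.cons_val_zero, Matrix.cons_val_one] at h
      exact h.2
    have hne₀ : ∀ w ∈ T₁, ∀ j, ((w 1 - w 0 : ℝ) : ℂ) + ((w 2 / (1 - w 2) : ℝ) : ℂ) * Complex.I ≠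
        ((e j : ℝ) : ℂ) := fun w hw j => lin_ne_branch_of_re (hT₁D w hw j).2
    have hne₁ : ∀ w ∈ T₁, ∀ j, ((w 1 : ℝ) : ℂ) + ((w 2 / (1 - w 2) : ℝ) : ℂ) * Complex.I ≠
        ((e j : ℝ) : ℂ) := fun w hw j => lin_ne_branch_of_re (hT₁D w hw j).1
    set Ω : Set (Fin 3 → ℝ) := {w : Fin 3 → ℝ | w 0 ∈ Ioi (0:ℝ) ∧ 0 < w 2 ∧ w 2 < 1} with hΩ
    have hΩs : IsSemialgebraic ℚ Ω := Engine.isSemialgebraic_prism hA 0 2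
    have hΩ1 : ∀ w ∈ Ω, w 2 ≠ 1 := fun w hw => ne_of_lt hw.2.2
    have hΩne₀ : ∀ w ∈ Ω, ∀ j, ((w 1 - w 0 : ℝ) : ℂ) + ((w 2 / (1 - w 2) : ℝ) : ℂ) * Complex.I ≠
        ((e j : ℝ) : ℂ) := fun w hw j =>
      lin_ne_branch_of_im (div_pos hw.2.1 (sub_pos.2 hw.2.2)).ne' j
    have hΩne₁ : ∀ w ∈ Ω, ∀ j, ((w 1 : ℝ) : ℂ) + ((w 2 / (1 - w 2) : ℝ) : ℂ) * Complex.I ≠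
        ((e j : ℝ) : ℂ) := fun w hw j =>
      lin_ne_branch_of_im (div_pos hw.2.1 (sub_pos.2 hw.2.2)).ne' j
    -- reading the kernels in the coordinates `w`
    have hVy : ∀ (y : Fin 2 → ℝ) (σ : ℝ), V ![y 0, y 1, σ] =
        if σ < 1 then (K (y 1 - y 0) (y 1) (σ / (1 - σ))).im else 0 := fun y σ => by
      rw [hV]; simp
    have hBy : ∀ (y : Fin 2 → ℝ) (σ : ℝ), B ![y 0, y 1, σ] =
        1 / (1 - σ) ^ 2 * (K' (y 1 - y 0) (y 1) (σ / (1 - σ))).re := fun y σ => by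
      rw [hB]; simp
    have hUa : ∀ (a τ σ : ℝ), U ![a, τ, σ] =
        1 / (1 - σ) ^ 2 * (K (τ - a) τ (σ / (1 - σ))).re := fun a τ σ => by
      rw [hU]; simp
    have hBa : ∀ (a τ σ : ℝ), B ![a, τ, σ] =
        1 / (1 - σ) ^ 2 * (K' (τ - a) τ (σ / (1 - σ))).re := fun a τ σ => by
      rw [hB]; simp
    refine ⟨hA, hD, fun y hy => hy.1, volume_diff_baseI e, ?_, ?_, ?_, ?_, ?_⟩
    · -- `V` on the closed band
      refine isSemialgebraicFunOn_ite hD hV ?_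
      exact (re_im_pairK hΦ (isSemialgebraicFunOn_sub_coord hT₁s) (isSemialgebraicFunOn_apply hT₁s 1)
        (isSemialgebraicFunOn_height hT₁s hT₁1) hne₀ hne₁).2.congr fun w _ => by rw [hK]
    · -- the fibres `σ ↦ V(y, σ)`
      intro y hy
      have h₀ : ∀ j, y 1 - y 0 ≠ (e j : ℝ) := fun j => (hy.2 j).2
      have h₁ : ∀ j, y 1 ≠ (e j : ℝ) := fun j => (hy.2 j).1
      have hfg : ∀ σ, σ < 1 → V ![y 0, y 1, σ] = (K (y 1 - y 0) (y 1) (σ / (1 - σ))).im :=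
        fun σ hσ => by rw [hVy, if_pos hσ]
      have hf1 : V ![y 0, y 1, 1] = 0 := by rw [hVy, if_neg (lt_irrefl _)]
      refine ⟨?_, hf1, fun σ hσ => ?_⟩
      · refine continuousOn_Icc_of_height (g := fun s => (K (y 1 - y 0) (y 1) s).im) hfg hf1 ?_ ?_
        · exact Complex.continuous_im.comp_continuousOn (continuousOn_K hΦ hK h₀ h₁)
        · simpa [Function.comp_def] using
            (Complex.continuous_im.tendsto 0).comp (tendsto_K_atTop hbd hK h₀ h₁)
      · rw [hBy]
        refine (hasDerivAt_imK_σ hΦ hK hK' _ _ hσ).congr_of_eventuallyEq ?_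
        filter_upwards [Iio_mem_nhds hσ.2] with τ hτ using hfg τ hτ
    · -- the bulk `B` on the open prism
      exact (IsSemialgebraicFunOn.mul_holds (isSemialgebraicFunOn_heightDeriv hΩs hΩ1)
        (re_im_pairK' hΦ (isSemialgebraicFunOn_sub_coord hΩs) (isSemialgebraicFunOn_apply hΩs 1)
          (isSemialgebraicFunOn_height hΩs hΩ1) hΩne₀ hΩne₁).1).congr fun w _ => by
        rw [Pi.mul_apply, hB, hK']
    · -- the abscissa primitive `U` on the open prism
      exact (IsSemialgebraicFunOn.mul_holds (isSemialgebraicFunOn_heightDeriv hΩs hΩ1)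
        (re_im_pairK hΦ (isSemialgebraicFunOn_sub_coord hΩs) (isSemialgebraicFunOn_apply hΩs 1)
          (isSemialgebraicFunOn_height hΩs hΩ1) hΩne₀ hΩne₁).1).congr fun w _ => by
        rw [Pi.mul_apply, hU, hK]
    · -- the fibres `τ ↦ U(a, τ, σ)`
      intro a _ σ hσ
      have hs : 0 < σ / (1 - σ) := height_pos hσ
      have hfun : (fun τ : ℝ => U ![a, τ, σ]) =
          fun τ => 1 / (1 - σ) ^ 2 * (K (τ - a) τ (σ / (1 - σ))).re := funext fun τ => hUa a τ σ
      have hlim : ∀ {l : Filter ℝ}, Tendsto (fun τ : ℝ => |τ|) l atTop →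
          Tendsto (fun τ => 1 / (1 - σ) ^ 2 * (K (τ - a) τ (σ / (1 - σ))).re) l (𝓝 0) := by
        intro l hl
        have h0 : Tendsto (fun τ : ℝ => (K (τ - a) τ (σ / (1 - σ))).re) l (𝓝 0) := by
          simpa [Function.comp_def] using (Complex.continuous_re.tendsto 0).comp
            (tendsto_K_τ hm hbd hK a hs.le hl)
        have := h0.const_mul (1 / (1 - σ) ^ 2)
        rwa [mul_zero] at this
      rw [hfun]
      refine ⟨fun τ => ?_, hlim tendsto_abs_atTop_atTop, hlim tendsto_abs_atBot_atTop⟩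
      rw [hBa]
      exact (hasDerivAt_reK_τ hΦ hK hK' a hs τ).const_mul _
  · /- (II) the spectator kernel over a gap `A = J_L` -/
    intro ρ k k' V U B hρ hk hk' hV hU hB L
    have hA := Faces.isSemialgebraic_gap e _ rfl L (0 : Fin 1)
    have hAE : ∀ t ∈ (![Set.Iio (e 0 : ℝ), Set.Ioo (e 0 : ℝ) (e 1 : ℝ), Set.Ioo (e 1 : ℝ) (e 2 : ℝ),
        Set.Ioo (e 2 : ℝ) (e 3 : ℝ), Set.Ioo (e 3 : ℝ) (e 4 : ℝ), Set.Ioi (e 4 : ℝ)] :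
          Fin 6 → Set ℝ) L, ∀ j, t ≠ (e j : ℝ) := fun t ht j => Faces.gap_ne e he _ rfl ht j
    revert hA hAE
    generalize (![Set.Iio (e 0 : ℝ), Set.Ioo (e 0 : ℝ) (e 1 : ℝ), Set.Ioo (e 1 : ℝ) (e 2 : ℝ),
      Set.Ioo (e 2 : ℝ) (e 3 : ℝ), Set.Ioo (e 3 : ℝ) (e 4 : ℝ), Set.Ioi (e 4 : ℝ)] :
        Fin 6 → Set ℝ) L = A
    intro hA hAE
    have hD := isSemialgebraic_baseII e hA
    -- the half-open band below `σ = 1` and the open prism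
    set T₁ : Set (Fin 3 → ℝ) := {w : Fin 3 → ℝ | (![w 0, w 1] : Fin 2 → ℝ) ∈
        {y : Fin 2 → ℝ | y 0 ∈ A ∧ ∀ j, y 1 ≠ (e j : ℝ)} ∧ 0 ≤ w 2 ∧ w 2 < 1} with hT₁
    have hT₁s : IsSemialgebraic ℚ T₁ := isSemialgebraic_band_lt hD
    have hT₁1 : ∀ w ∈ T₁, w 2 ≠ 1 := fun w hw => ne_of_lt hw.2.2
    have hT₁D : ∀ w ∈ T₁, w 0 ∈ A ∧ ∀ j, w 1 ≠ (e j : ℝ) := fun w hw => by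
      have h := hw.1
      simp only [mem_setOf_eq, Matrix.cons_val_zero, Matrix.cons_val_one] at h
      exact h
    have hT₁0 : ∀ w ∈ T₁, ∀ j, w 0 ≠ (e j : ℝ) := fun w hw j => hAE _ (hT₁D w hw).1 j
    have hne : ∀ w ∈ T₁, ∀ j, ((w 1 : ℝ) : ℂ) + ((w 2 / (1 - w 2) : ℝ) : ℂ) * Complex.I ≠
        ((e j : ℝ) : ℂ) := fun w hw j => lin_ne_branch_of_re ((hT₁D w hw).2 j)
    set Ω : Set (Fin 3 → ℝ) := {w : Fin 3 → ℝ | w 0 ∈ A ∧ 0 < w 2 ∧ w 2 < 1} with hΩ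
    have hΩs : IsSemialgebraic ℚ Ω := Engine.isSemialgebraic_prism hA 0 2
    have hΩ1 : ∀ w ∈ Ω, w 2 ≠ 1 := fun w hw => ne_of_lt hw.2.2
    have hΩ0 : ∀ w ∈ Ω, ∀ j, w 0 ≠ (e j : ℝ) := fun w hw j => hAE _ hw.1 j
    have hΩne : ∀ w ∈ Ω, ∀ j, ((w 1 : ℝ) : ℂ) + ((w 2 / (1 - w 2) : ℝ) : ℂ) * Complex.I ≠
        ((e j : ℝ) : ℂ) := fun w hw j =>
      lin_ne_branch_of_im (div_pos hw.2.1 (sub_pos.2 hw.2.2)).ne' j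
    -- reading the kernels in the coordinates `w`
    have hVy : ∀ (y : Fin 2 → ℝ) (σ : ℝ), V ![y 0, y 1, σ] =
        if σ < 1 then ρ (y 0) * (k (y 1) (σ / (1 - σ))).re else 0 := fun y σ => by
      rw [hV]; simp
    have hBy : ∀ (y : Fin 2 → ℝ) (σ : ℝ), B ![y 0, y 1, σ] =
        -(1 / (1 - σ) ^ 2 * ρ (y 0) * (k' (y 1) (σ / (1 - σ))).im) := fun y σ => by
      rw [hB]; simp
    have hUa : ∀ (a τ σ : ℝ), U ![a, τ, σ] =
        -(1 / (1 - σ) ^ 2 * ρ a * (k τ (σ / (1 - σ))).im) := fun a τ σ => by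
      rw [hU]; simp
    have hBa : ∀ (a τ σ : ℝ), B ![a, τ, σ] =
        -(1 / (1 - σ) ^ 2 * ρ a * (k' τ (σ / (1 - σ))).im) := fun a τ σ => by
      rw [hB]; simp
    refine ⟨hA, hD, fun y hy => hy.1, volume_diff_baseII e A, ?_, ?_, ?_, ?_, ?_⟩
    · -- `V` on the closed band
      refine isSemialgebraicFunOn_ite hD hV ?_
      exact (IsSemialgebraicFunOn.mul_holds (isSemialgebraicFunOn_rho hρ hT₁s hT₁0)
        (re_im_singlek hΦ (isSemialgebraicFunOn_apply hT₁s 1)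
          (isSemialgebraicFunOn_height hT₁s hT₁1) hne).1).congr fun w _ => by rw [Pi.mul_apply, hk]
    · -- the fibres `σ ↦ V(y, σ)`
      intro y hy
      have h₁ : ∀ j, y 1 ≠ (e j : ℝ) := fun j => hy.2 j
      have hfg : ∀ σ, σ < 1 → V ![y 0, y 1, σ] = ρ (y 0) * (k (y 1) (σ / (1 - σ))).re :=
        fun σ hσ => by rw [hVy, if_pos hσ]
      have hf1 : V ![y 0, y 1, 1] = 0 := by rw [hVy, if_neg (lt_irrefl _)]
      refine ⟨?_, hf1, fun σ hσ => ?_⟩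
      · refine continuousOn_Icc_of_height (g := fun s => ρ (y 0) * (k (y 1) s).re) hfg hf1 ?_ ?_
        · exact continuousOn_const.mul
            (Complex.continuous_re.comp_continuousOn (continuousOn_k hΦ hk h₁))
        · have h0 : Tendsto (fun s : ℝ => (k (y 1) s).re) atTop (𝓝 0) := by
            simpa [Function.comp_def] using
              (Complex.continuous_re.tendsto 0).comp (tendsto_k_atTop hbd hk h₁)
          have := h0.const_mul (ρ (y 0))
          rwa [mul_zero] at this
      · rw [hBy]
        refine (((hasDerivAt_rek_σ hΦ hk hk' _ hσ).const_mul (ρ (y 0))).congr_deriv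
          (by ring)).congr_of_eventuallyEq ?_
        filter_upwards [Iio_mem_nhds hσ.2] with τ hτ using hfg τ hτ
    · -- the bulk `B` on the open prism
      exact ((IsSemialgebraicFunOn.mul_holds (IsSemialgebraicFunOn.mul_holds
        (isSemialgebraicFunOn_heightDeriv hΩs hΩ1) (isSemialgebraicFunOn_rho hρ hΩs hΩ0))
        (re_im_singlek' hΦ (isSemialgebraicFunOn_apply hΩs 1) (isSemialgebraicFunOn_height hΩs hΩ1)
          hΩne).2).neg).congr fun w _ => by
        rw [Pi.neg_apply, Pi.mul_apply, Pi.mul_apply, hB, hk']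
    · -- the abscissa primitive `U` on the open prism
      exact ((IsSemialgebraicFunOn.mul_holds (IsSemialgebraicFunOn.mul_holds
        (isSemialgebraicFunOn_heightDeriv hΩs hΩ1) (isSemialgebraicFunOn_rho hρ hΩs hΩ0))
        (re_im_singlek hΦ (isSemialgebraicFunOn_apply hΩs 1) (isSemialgebraicFunOn_height hΩs hΩ1)
          hΩne).2).neg).congr fun w _ => by
        rw [Pi.neg_apply, Pi.mul_apply, Pi.mul_apply, hU, hk]
    · -- the fibres `τ ↦ U(a, τ, σ)`
      intro a _ σ hσ
      have hs : 0 < σ / (1 - σ) := height_pos hσ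
      have hfun : (fun τ : ℝ => U ![a, τ, σ]) =
          fun τ => -(1 / (1 - σ) ^ 2 * ρ a * (k τ (σ / (1 - σ))).im) := funext fun τ => hUa a τ σ
      have hlim : ∀ {l : Filter ℝ}, Tendsto (fun τ : ℝ => |τ|) l atTop →
          Tendsto (fun τ => -(1 / (1 - σ) ^ 2 * ρ a * (k τ (σ / (1 - σ))).im)) l (𝓝 0) := by
        intro l hl
        have h0 : Tendsto (fun τ : ℝ => (k τ (σ / (1 - σ))).im) l (𝓝 0) := by
          simpa [Function.comp_def] using (Complex.continuous_im.tendsto 0).comp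
            (tendsto_k_τ hm hbd hk hs.le hl)
        have := (h0.const_mul (1 / (1 - σ) ^ 2 * ρ a)).neg
        rwa [mul_zero, neg_zero] at this
      rw [hfun]
      refine ⟨fun τ => ?_, hlim tendsto_abs_atTop_atTop, hlim tendsto_abs_atBot_atTop⟩
      rw [hBa]
      exact ((hasDerivAt_imk_τ hΦ hk hk' hs τ).const_mul _).neg

end Summit.KontsevichZagierPeriods.UnfoldedStokes.HyperellipticRiemannRelationLine
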